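import Literature.NumberTheory.Irrationality.LaiYu2020.AnalysisLemmaProfile
import Literature.NumberTheory.Irrationality.LaiYu2020.LinearFormsProofs
import Literature.NumberTheory.Irrationality.LaiYu2020.ZeroSetSymmetry
import Literature.NumberTheory.Transcendental.OddZetaAsymptotics
import Literature.NumberTheory.Irrationality.FischlerSprangZudilin2019.Lemma3Limit
import Mathlib.Analysis.Complex.Exponential
import HarnessLib

/-!
# Lai–Yu 2020, Lemma 4.1 — part 3: `r_{n,θ} = ∑_k R̂_n(k+θ)`, the tail, and
# `lim r_{n,θ}^{1/n} = g(x₀)`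

Topic `Literature/NumberTheory/Irrationality/LaiYu2020`, namespace
`Literature.NumberTheory.Irrationality.LaiYu2020` (helpers in `Lemma41`). Source: L. Lai, P. Yu, *A note on the
number of irrational odd zeta values*, Compositio Math. **156** (2020) 1699–1717 = arXiv:1911.08458 [LaiYu2020],
§4 proof of Lemma 4.1 (held: `paper:arxiv-1911.08458`, arXiv text pp. 8–9, read on the page). Third of the files
PROVING Lemma 4.1; everything here is proved, no named facts.

## The source, verbatim (the steps formalised here)
"For any `θ ∈ 𝓕_B`, since `R_n(m+θ) = 0` for `m = 1,2,⋯,rn−1`, we define … `R̂_n(t) = R_n(t+rn)`, then by (2.4)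
we have `r_{n,θ} = ∑_{k=0}^{∞} R̂_n(k+θ)` (4.4). … we divide it into three parts … Finally, for the tail part, for
any `k > n^{10}`, … `R̂_n(k+θ) < (2A₁(B)A₂(B)n)^{(s+1)n}/k^{(9/10)(s+1)n+2} < (g(x₀)/2)ⁿ (1/k²)`. As a conclusion,
we obtain the following bound for the tail part for all sufficiently large `n`: `∑_{k>n^{10}} R̂_n(k+θ) ≤ (g(x₀)/2)ⁿ`
(4.9). Now, in view of the estimates (4.6), (4.8) and (4.9), we have `r_{n,1} ≤ n^{O(1)} g(x₀)ⁿ`. On the other hand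
(4.7) implies that `r_{n,1} ≥ R̂_n(⌊x₀n⌋) = n^{O(1)} h(x₀+o(1))ⁿ`. Therefore, `lim_{n→+∞} (r_{n,1})^{1/n} = g(x₀)`."

## What is proved here
* `R_natCast_add_eq_zero` (the zeros `R_n(m'+θ) = 0`, `0 ≤ m' ≤ rn−1`, `θ ∈ 𝓕_B`), the series
  `rT u v s B m θ = ∑_k R̂_n(k+θ)` and **`hasSum_cT`**: it IS the linear form `r_{n,θ}` of Lemma 2.5
  (`LinearFormsProofs.lemma25`, re-indexed by `rn = um`), `rT_pos`.
* the far tail (DEVIATION: cut at `k > An` with a constant `A` instead of the printed `k > n^{10}`, as in the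
  tree's FSZ `Lemma3Limit.lean`): `cT_le_tail` (`R̂_n(k+θ) ≤ 2·((A₁A₂)^v (2e·v)^{(2u+v)N}/A^{d})^m/k²` for
  `k ≥ A n`, `d = (s+1)v − (2u+v)N ≥ 1`), `summable_cT`, `tsum_tail_le`, `exists_A`, `tsum_tail_le_geom`
  (`≤ 2(g(x₀)/2)ⁿ`, the printed (4.9));
* the body `k ≤ An` (the printed (4.7)–(4.8), from `AnalysisLemmaTerms.lean`): `exists_body_bound`,
  `cT_exp_bounds`; **`rT_le_exp`** (`r_{n,θ} ≤ g(x₀)ⁿ e^{K(1+log(n+1))}` for ALL admissible `n`, `θ ∈ (0,1]` —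
  the printed `r_{n,1} ≤ n^{O(1)} g(x₀)ⁿ`), `exp_le_rT` (the single term `k = ⌊x₀n⌋+1`),
  **`tendsto_log_rT_div`** (`log r_{n,θ}/n → log g(x₀)`) and **`tendsto_rT_rpow`** (`r_{n,θ}^{1/n} → g(x₀)`) —
  the first assertion of Lemma 4.1, for every `θ ∈ (0,1]` (in print for `θ = 1`; the general `θ` follows there
  from the second assertion).
Parameters: `r = u/v` (`u, v ≥ 1`), `n = vm` (`m → ∞`), `N = |𝓕_B|`, `(2u+v)N < (s+1)v`, `s ≥ 2`.

## Not here
The ratio `r_{n,1}/r_{n,θ} → 1` (Lemma 4.1, second assertion): `AnalysisLemmaRatio.lean`. Cell zeta5-irr (rung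
F-Z1): nothing here bears on `ζ(5)`.
-/

noncomputable section

open Finset Filter Set

open scoped Nat Topology

namespace Literature.NumberTheory.Irrationality.LaiYu2020

open Literature.NumberTheory.Transcendental.BallRivoal (pfEval)
open Literature.NumberTheory.Irrationality.DirichletLValues (hurwitzValue)

namespace Lemma41

/-! ### The zeros `R_n(m'+θ) = 0`, `m' ≤ rn − 1`, and `r_{n,θ} = ∑_k R̂_n(k+θ)` -/

/-- **`R_n(m'+θ) = 0` for integers `0 ≤ m' ≤ rn − 1` and `θ ∈ 𝓕_B`** (`rn = um`, `B ≥ 1`): for `θ < 1` the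
numerator factor `t − rn + j + θ'` with `θ' = 1−θ ∈ 𝓕_B`, `j = rn − m' − 1` vanishes; for `θ = 1` either `t = rn`
or the factor with `θ' = 1`, `j = rn − m' − 2`.
[cite: LaiYu2020, §4 proof of Lemma 4.1 ("R_n(m+θ) = 0 for m = 1, 2, ⋯, rn−1")] -/
theorem R_natCast_add_eq_zero {u v s : ℕ} {B : ℝ} (hB : 1 ≤ B) {m : ℕ} {θ : ℚ} (hθ : θ ∈ zeroSet B)
    {m' : ℕ} (hm' : m' + 1 ≤ u * m) : R u v s B m ((m' : ℚ) + θ) = 0 := by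
  obtain ⟨hθ0, hθ1, -⟩ := (mem_zeroSet).1 hθ
  rw [R]
  have hL : u * m ≤ (2 * u + v) * m := by nlinarith
  rcases lt_or_eq_of_le hθ1 with hlt | heq
  · have hmem : (1 - θ) ∈ (zeroSet_finite B).toFinset :=
      (zeroSet_finite B).mem_toFinset.2 (one_sub_mem_zeroSet hθ hlt)
    have hj : u * m - m' - 1 ∈ range ((2 * u + v) * m) := by
      rw [Finset.mem_range]; omega
    have hzero : ∏ θ' ∈ (zeroSet_finite B).toFinset, ∏ j ∈ range ((2 * u + v) * m),
        ((m' : ℚ) + θ - u * m + j + θ') = 0 := by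
      refine prod_eq_zero hmem (prod_eq_zero hj ?_)
      rw [Nat.sub_sub, Nat.cast_sub (by omega : m' + 1 ≤ u * m)]
      push_cast
      ring
    rw [hzero, mul_zero, mul_zero, zero_div]
  · rcases Nat.eq_or_lt_of_le hm' with h1 | h2
    · have : ((m' : ℚ) + θ - u * m) = 0 := by
        rw [heq]
        have : ((u * m : ℕ) : ℚ) = (m' : ℚ) + 1 := by rw [← h1]; push_cast; ring
        push_cast at this
        linarith
      rw [this, zero_mul, mul_zero, zero_div]
    · have hmem : (1 : ℚ) ∈ (zeroSet_finite B).toFinset :=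
        (zeroSet_finite B).mem_toFinset.2 (one_mem_zeroSet hB)
      have hj : u * m - m' - 2 ∈ range ((2 * u + v) * m) := by
        rw [Finset.mem_range]; omega
      have hzero : ∏ θ' ∈ (zeroSet_finite B).toFinset, ∏ j ∈ range ((2 * u + v) * m),
          ((m' : ℚ) + θ - u * m + j + θ') = 0 := by
        refine prod_eq_zero hmem (prod_eq_zero hj ?_)
        rw [heq, Nat.sub_sub, Nat.cast_sub (by omega : m' + 2 ≤ u * m)]
        push_cast
        ring
      rw [hzero, mul_zero, mul_zero, zero_div]

/-- **The series `r_{n,θ} = ∑_{k ≥ 0} R̂_n(k+θ)`** (as a real number; `n = vm`, `r = u/v`).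
[cite: LaiYu2020, §4 proof of Lemma 4.1, eq. (4.4)] -/
def rT (u v s : ℕ) (B : ℝ) (m : ℕ) (θ : ℚ) : ℝ := ∑' k, cT u v s B m θ k

/-- **`r_{n,θ} = ∑_k R̂_n(k+θ)` IS the linear form of Lemma 2.5**: under the hypotheses of `lemma25` (`s` odd,
`n = vm` even, `B ≥ 1`, `deg R_n ≤ −2`, `rn ≥ 1`), `∑_k R̂_n(k+θ)` converges to
`ρ_{0,θ} + ∑_{3 ≤ i ≤ s, i odd} ρ_i ζ(i, θ)` (the first `rn − 1` terms of `∑_{m ≥ 1} R_n(m+θ)` vanish).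
[cite: LaiYu2020, §4 proof of Lemma 4.1, eq. (4.4) ("by (2.4) we have r_{n,θ} = ∑_{k ≥ 0} R̂_n(k+θ)")] -/
theorem hasSum_cT {u v s : ℕ} {B : ℝ} {m : ℕ} (hB : 1 ≤ B) (hs : Odd s) (hn : Even (v * m))
    (hum : 1 ≤ u * m)
    (hdeg : 1 + (2 * u + v) * m * (zeroSet_finite B).toFinset.card + 2 ≤ (s + 1) * (v * m + 1))
    {c : ℕ → ℕ → ℚ}
    (hc : ∀ t : ℚ, (∀ p : ℕ, p ≤ v * m → t + p + 1 ≠ 0) →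
      pfEval (v * m) (s + 1) c t = R u v s B m (t + 1))
    {θ : ℚ} (hθ : θ ∈ zeroSet B) :
    HasSum (fun k : ℕ => cT u v s B m θ k)
      (((-∑ k ∈ range (v * m + 1), ∑ ℓ ∈ range (k + 1), ∑ o ∈ range (s + 1),
          c o k / ((ℓ : ℚ) + θ) ^ (o + 1) : ℚ) : ℝ) +
        ∑ i ∈ (Finset.Icc 3 s).filter Odd,
          ((∑ k ∈ range (v * m + 1), c (i - 1) k : ℚ) : ℝ) * hurwitzValue i (θ : ℝ)) := by
  have hM : 1 ≤ (2 * u + v) * m := by nlinarith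
  have h0 := lemma25 hB hs hn hM hdeg hc hθ
  have h := (hasSum_nat_add_iff' (f := fun k : ℕ => (R u v s B m ((k : ℚ) + 1 + θ) : ℝ)) (u * m - 1)).2 h0
  have hzero : ∑ i ∈ range (u * m - 1), (R u v s B m ((i : ℚ) + 1 + θ) : ℝ) = 0 := by
    refine sum_eq_zero fun i hi => ?_
    have h0 := R_natCast_add_eq_zero (u := u) (v := v) (s := s) (m := m) hB hθ (m' := i + 1)
      (by have := Finset.mem_range.1 hi; omega)
    push_cast at h0
    rw [h0, Rat.cast_zero]
  rw [hzero, sub_zero] at h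
  refine h.congr_fun fun q => ?_
  have e : (((q + (u * m - 1) : ℕ) : ℚ) + 1 + θ) = (u : ℚ) * m + q + θ := by
    rw [Nat.cast_add, Nat.cast_sub hum]
    push_cast
    ring
  rw [e, R_cast_eq_cT]

/-! ### The far tail `k ≥ An` -/

/-- The numerator at `k ≥ (2u+v)m + 2`: `(k+θ) ∏_{θ'} ∏_{j<(2u+v)m} (k+θ+j+θ') ≤ (2k)^{(2u+v)Nm+1}`
(`θ, θ' ≤ 1`). [cite: LaiYu2020, §4 proof of Lemma 4.1 (tail part, "with some trivial estimates")] -/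
theorem num_le_pow {u v : ℕ} {B : ℝ} {m k : ℕ} (hk : (2 * u + v) * m + 2 ≤ k) {θ : ℚ} (hθ0 : 0 < θ)
    (hθ1 : θ ≤ 1) :
    ((k : ℝ) + θ) * ∏ θ' ∈ (zeroSet_finite B).toFinset, ∏ j ∈ range ((2 * u + v) * m),
        ((k : ℝ) + θ + j + θ') ≤
      (2 * (k : ℝ)) ^ ((2 * u + v) * (zeroSet_finite B).toFinset.card * m + 1) := by
  have hθ0' : (0 : ℝ) < θ := by exact_mod_cast hθ0
  have hθ1' : (θ : ℝ) ≤ 1 := by exact_mod_cast hθ1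
  have hk' : ((2 * u + v) * m : ℝ) + 2 ≤ k := by exact_mod_cast hk
  have hk1 : (1 : ℝ) ≤ k := by
    have : (0 : ℝ) ≤ ((2 * u + v) * m : ℝ) := by positivity
    linarith
  have hprod : ∏ θ' ∈ (zeroSet_finite B).toFinset, ∏ j ∈ range ((2 * u + v) * m), ((k : ℝ) + θ + j + θ') ≤
      (2 * (k : ℝ)) ^ ((2 * u + v) * (zeroSet_finite B).toFinset.card * m) := by
    rw [show (2 * u + v) * (zeroSet_finite B).toFinset.card * m = ((2 * u + v) * m) *
      (zeroSet_finite B).toFinset.card by ring, pow_mul, ← prod_const]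
    refine prod_le_prod (fun θ' hθ' => prod_nonneg fun j _ => ?_) fun θ' hθ' => ?_
    · have : (0 : ℝ) < θ' := by exact_mod_cast (mem_toFinset_pos hθ').1
      positivity
    · obtain ⟨hp, hle⟩ := mem_toFinset_pos hθ'
      have hp' : (0 : ℝ) < θ' := by exact_mod_cast hp
      have hle' : (θ' : ℝ) ≤ 1 := by exact_mod_cast hle
      rw [← card_range ((2 * u + v) * m), ← prod_const, card_range]
      refine prod_le_prod (fun j _ => by positivity) fun j hj => ?_
      have hj' : (j : ℝ) + 1 ≤ ((2 * u + v) * m : ℝ) := by exact_mod_cast Finset.mem_range.1 hj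
      linarith
  rw [pow_succ]
  calc ((k : ℝ) + θ) * ∏ θ' ∈ (zeroSet_finite B).toFinset, ∏ j ∈ range ((2 * u + v) * m),
        ((k : ℝ) + θ + j + θ')
      ≤ (2 * (k : ℝ)) * (2 * (k : ℝ)) ^ ((2 * u + v) * (zeroSet_finite B).toFinset.card * m) :=
        mul_le_mul (by linarith) hprod (prod_nonneg fun θ' hθ' => prod_nonneg fun j _ => by
          have : (0 : ℝ) < θ' := by exact_mod_cast (mem_toFinset_pos hθ').1
          positivity) (by positivity)
    _ = _ := by ring

/-- The denominator at `k`: `k^{(n+1)(s+1)} ≤ (∏_{j ≤ n} (um+k+θ+j))^{s+1}` (`θ > 0`).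
[cite: LaiYu2020, §4 proof of Lemma 4.1 (tail part, "with some trivial estimates")] -/
theorem pow_le_den (u v s : ℕ) (m k : ℕ) {θ : ℚ} (hθ0 : 0 < θ) :
    (k : ℝ) ^ ((v * m + 1) * (s + 1)) ≤ (∏ j ∈ range (v * m + 1), ((u : ℝ) * m + k + θ + j)) ^ (s + 1) := by
  have hθ0' : (0 : ℝ) < θ := by exact_mod_cast hθ0
  rw [pow_mul]
  refine pow_le_pow_left₀ (by positivity) ?_ _
  rw [← card_range (v * m + 1), ← prod_const, card_range]
  exact prod_le_prod (fun _ _ => by positivity) fun j _ => by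
    have : (0 : ℝ) ≤ (u : ℝ) * m := by positivity
    have : (0 : ℝ) ≤ (j : ℝ) := by positivity
    linarith

/-- The prefactor: `pref ≤ A₁ⁿ A₂ⁿ · n^{n(s+1)} · e^{(2u+v)Nm} / m^{(2u+v)Nm}` (`n! ≤ nⁿ`, `mᵐ/m! ≤ eᵐ`).
[cite: LaiYu2020, §4 proof of Lemma 4.1 (tail part, "(2A₁(B)A₂(B)n)^{(s+1)n}")] -/
theorem pref_le {u v s : ℕ} {B : ℝ} {m : ℕ} (hm : 1 ≤ m) :
    pref u v s B m ≤ (A₁pow u v B m : ℝ) * (A₂pow u v B m : ℝ) * ((v * m : ℕ) : ℝ) ^ (v * m * (s + 1)) *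
      (Real.exp 1 ^ m / (m : ℝ) ^ m) ^ ((2 * u + v) * (zeroSet_finite B).toFinset.card) := by
  have hA1 : (0 : ℝ) < A₁pow u v B m := by exact_mod_cast A₁pow_pos u v B m
  have hA2 : (0 : ℝ) < A₂pow u v B m := by exact_mod_cast A₂pow_pos u v B m
  have hm0 : (0 : ℝ) < m := by exact_mod_cast hm
  have hfac : (((v * m)! : ℕ) : ℝ) ^ (s + 1) ≤ ((v * m : ℕ) : ℝ) ^ (v * m * (s + 1)) := by
    rw [pow_mul]
    exact pow_le_pow_left₀ (by positivity) (by exact_mod_cast Nat.factorial_le_pow (v * m)) _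
  have hinv : 1 / ((m ! : ℕ) : ℝ) ≤ Real.exp 1 ^ m / (m : ℝ) ^ m := by
    have h := Real.pow_div_factorial_le_exp (m : ℝ) (Nat.cast_nonneg m) m
    rw [← Real.exp_one_pow] at h
    rw [div_le_div_iff₀ (by positivity) (by positivity), one_mul]
    rw [div_le_iff₀ (by positivity)] at h
    linarith
  have hinvE : 1 / ((m ! : ℕ) : ℝ) ^ ((2 * u + v) * (zeroSet_finite B).toFinset.card) ≤
      (Real.exp 1 ^ m / (m : ℝ) ^ m) ^ ((2 * u + v) * (zeroSet_finite B).toFinset.card) := by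
    rw [← one_div_pow]
    exact pow_le_pow_left₀ (by positivity) hinv _
  unfold pref
  rw [div_eq_mul_one_div]
  exact mul_le_mul (mul_le_mul_of_nonneg_left hfac (by positivity)) hinvE (by positivity) (by positivity)

/-- **Far-tail bound** (`k ≥ An`, `A ≥ 2u+v+2`, `m ≥ 1`, `(2u+v)N ≤ (s+1)v`, `s ≥ 2`): with
`d = (s+1)v − (2u+v)N`,
`R̂_n(k+θ) ≤ 2 · (A₁A₂)ⁿ (2ev)^{(2u+v)Nm} / (A^{dm} k²)` — the printed "`< (g(x₀)/2)ⁿ/k²`" before the choice of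
the cut-off. [cite: LaiYu2020, §4 proof of Lemma 4.1 (tail part)] -/
theorem cT_le_tail {u v s : ℕ} {B : ℝ} {m : ℕ} (hv : 1 ≤ v) (hm : 1 ≤ m) (hs : 2 ≤ s)
    (hNs : (2 * u + v) * (zeroSet_finite B).toFinset.card ≤ (s + 1) * v)
    {θ : ℚ} (hθ0 : 0 < θ) (hθ1 : θ ≤ 1) {A k : ℕ} (hA : 2 * u + v + 2 ≤ A) (hk : A * (v * m) ≤ k) :
    cT u v s B m θ k ≤ 2 * ((A₁pow u v B m : ℝ) * (A₂pow u v B m : ℝ) *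
      (2 * Real.exp 1 * v) ^ ((2 * u + v) * (zeroSet_finite B).toFinset.card * m)) /
      ((A : ℝ) ^ (((s + 1) * v - (2 * u + v) * (zeroSet_finite B).toFinset.card) * m) * (k : ℝ) ^ 2) := by
  set N : ℕ := (zeroSet_finite B).toFinset.card with hN
  set E : ℕ := (2 * u + v) * N with hE
  obtain ⟨d, hd⟩ := Nat.exists_eq_add_of_le hNs
  have hdE : (s + 1) * v - E = d := by rw [hE, hd]; omega
  rw [hdE]
  have hv0 : (0 : ℝ) < v := by exact_mod_cast hv
  have hm0 : (0 : ℝ) < m := by exact_mod_cast hm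
  have hA1 : (1 : ℝ) ≤ A := by exact_mod_cast (le_trans (by omega) hA : 1 ≤ A)
  have hA0 : (0 : ℝ) < A := by linarith
  have hkL : (2 * u + v) * m + 2 ≤ k := by
    have h1 : (2 * u + v + 2) * (v * m) ≤ k := le_trans (Nat.mul_le_mul_right _ hA) hk
    nlinarith
  have hk1 : 1 ≤ k := by omega
  have hk0 : (0 : ℝ) < k := by exact_mod_cast hk1
  have hkA : (A : ℝ) * (v * m) ≤ k := by exact_mod_cast hk
  have hA12 : (0 : ℝ) < (A₁pow u v B m : ℝ) * (A₂pow u v B m : ℝ) :=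
    mul_pos (by exact_mod_cast A₁pow_pos u v B m) (by exact_mod_cast A₂pow_pos u v B m)
  -- Step 1: cT ≤ pref · 2^{Em+1} / k^{md+s}
  have hexp : (v * m + 1) * (s + 1) = (E * m + 1) + (d * m + s) := by
    have : (s + 1) * v = E + d := hd
    nlinarith
  have hnum := num_le_pow (u := u) (v := v) (B := B) (m := m) hkL hθ0 hθ1
  rw [← hN, show (2 * u + v) * N * m = E * m by rw [hE]] at hnum
  have hden := pow_le_den u v s m k hθ0
  have hp0 := (pref_pos u v s B m).le
  have hstep1 : cT u v s B m θ k ≤ pref u v s B m * (2 : ℝ) ^ (E * m + 1) / (k : ℝ) ^ (d * m + s) := by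
    unfold cT
    rw [div_le_div_iff₀ (lt_of_lt_of_le (by positivity) hden) (by positivity)]
    calc pref u v s B m * (((k : ℝ) + θ) * ∏ θ' ∈ (zeroSet_finite B).toFinset,
          ∏ j ∈ range ((2 * u + v) * m), ((k : ℝ) + θ + j + θ')) * (k : ℝ) ^ (d * m + s)
        ≤ pref u v s B m * (2 * (k : ℝ)) ^ (E * m + 1) * (k : ℝ) ^ (d * m + s) :=
          mul_le_mul_of_nonneg_right (mul_le_mul_of_nonneg_left hnum hp0) (by positivity)
      _ = pref u v s B m * 2 ^ (E * m + 1) * (k : ℝ) ^ ((v * m + 1) * (s + 1)) := by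
          rw [hexp, pow_add, mul_pow]; ring
      _ ≤ pref u v s B m * 2 ^ (E * m + 1) *
          (∏ j ∈ range (v * m + 1), ((u : ℝ) * m + k + θ + j)) ^ (s + 1) :=
          mul_le_mul_of_nonneg_left hden (mul_nonneg hp0 (by positivity))
  -- Step 2: pref ≤ A12 · v^{Em} (vm)^{dm} · e^{Em}  (since (vm)^{vm(s+1)} = v^{Em} m^{Em} (vm)^{dm})
  have hpref := pref_le (u := u) (v := v) (s := s) (B := B) hm
  rw [← hN, ← hE] at hpref
  have hvm : v * m * (s + 1) = E * m + d * m := by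
    have : (s + 1) * v = E + d := hd
    nlinarith
  have hpref' : pref u v s B m ≤ (A₁pow u v B m : ℝ) * (A₂pow u v B m : ℝ) *
      ((v : ℝ) ^ (E * m) * ((v : ℝ) * m) ^ (d * m) * Real.exp 1 ^ (E * m)) := by
    refine hpref.trans (le_of_eq ?_)
    rw [hvm, pow_add, div_pow, ← pow_mul, ← pow_mul, show m * E = E * m by ring]
    push_cast
    rw [mul_pow]
    field_simp
  -- Step 3: k^{dm+s} ≥ k² (A v m)^{dm}
  have hkpow : (k : ℝ) ^ 2 * ((A : ℝ) * (v * m)) ^ (d * m) ≤ (k : ℝ) ^ (d * m + s) := by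
    obtain ⟨s', hs'⟩ := Nat.exists_eq_add_of_le hs
    rw [hs', show d * m + (2 + s') = 2 + (d * m + s') by ring, pow_add (k : ℝ) 2, pow_add]
    refine mul_le_mul_of_nonneg_left ?_ (by positivity)
    calc ((A : ℝ) * (v * m)) ^ (d * m) ≤ (k : ℝ) ^ (d * m) := pow_le_pow_left₀ (by positivity) hkA _
      _ = (k : ℝ) ^ (d * m) * 1 := (mul_one _).symm
      _ ≤ (k : ℝ) ^ (d * m) * (k : ℝ) ^ s' :=
          mul_le_mul_of_nonneg_left (one_le_pow₀ (by exact_mod_cast hk1)) (by positivity)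
  -- assemble
  have hkey : pref u v s B m * (2 : ℝ) ^ (E * m + 1) / (k : ℝ) ^ (d * m + s) ≤
      2 * ((A₁pow u v B m : ℝ) * (A₂pow u v B m : ℝ) * (2 * Real.exp 1 * v) ^ (E * m)) /
        ((A : ℝ) ^ (d * m) * (k : ℝ) ^ 2) := by
    rw [div_le_div_iff₀ (by positivity) (by positivity)]
    calc pref u v s B m * 2 ^ (E * m + 1) * ((A : ℝ) ^ (d * m) * (k : ℝ) ^ 2)
        ≤ ((A₁pow u v B m : ℝ) * (A₂pow u v B m : ℝ) *
            ((v : ℝ) ^ (E * m) * ((v : ℝ) * m) ^ (d * m) * Real.exp 1 ^ (E * m))) * 2 ^ (E * m + 1) *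
            ((A : ℝ) ^ (d * m) * (k : ℝ) ^ 2) := by gcongr
      _ = 2 * ((A₁pow u v B m : ℝ) * (A₂pow u v B m : ℝ) * (2 * Real.exp 1 * v) ^ (E * m)) *
            ((k : ℝ) ^ 2 * ((A : ℝ) * (v * m)) ^ (d * m)) := by
          rw [mul_pow, mul_pow, mul_pow, mul_pow, pow_succ]; ring
      _ ≤ 2 * ((A₁pow u v B m : ℝ) * (A₂pow u v B m : ℝ) * (2 * Real.exp 1 * v) ^ (E * m)) *
            (k : ℝ) ^ (d * m + s) := mul_le_mul_of_nonneg_left hkpow (by positivity)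
  rw [show E * m = (2 * u + v) * N * m by rw [hE]] at hkey
  exact hstep1.trans hkey

/-- The tail constant: `Ctail = (A₁A₂)^{v} (2ev)^{(2u+v)N}` per unit of `m`
(`(A₁ⁿA₂ⁿ)(2ev)^{(2u+v)Nm} = Ctail^m`). [cite: LaiYu2020, §4 proof of Lemma 4.1 (tail part)] -/
theorem A12_pow_eq {u v : ℕ} (hv : 1 ≤ v) (B : ℝ) (m : ℕ) :
    (A₁pow u v B m : ℝ) * (A₂pow u v B m : ℝ) *
        (2 * Real.exp 1 * v) ^ ((2 * u + v) * (zeroSet_finite B).toFinset.card * m) =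
      ((A₁ ((u : ℚ) / v) B * A₂ ((u : ℚ) / v) B) ^ v *
        (2 * Real.exp 1 * v) ^ ((2 * u + v) * (zeroSet_finite B).toFinset.card)) ^ m := by
  rw [← A₁_pow hv B m, ← A₂_pow hv B m]
  ring

/-- **Summability of `∑_k R̂_n(k+θ)`** (no parity hypotheses).
[cite: LaiYu2020, §4 proof of Lemma 4.1, eq. (4.4)] -/
theorem summable_cT {u v s : ℕ} {B : ℝ} {m : ℕ} (hv : 1 ≤ v) (hm : 1 ≤ m) (hs : 2 ≤ s)
    (hNs : (2 * u + v) * (zeroSet_finite B).toFinset.card ≤ (s + 1) * v)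
    {θ : ℚ} (hθ0 : 0 < θ) (hθ1 : θ ≤ 1) :
    Summable (fun k => cT u v s B m θ k) := by
  set A : ℕ := 2 * u + v + 2 with hA
  set Cst : ℝ := 2 * ((A₁pow u v B m : ℝ) * (A₂pow u v B m : ℝ) *
      (2 * Real.exp 1 * v) ^ ((2 * u + v) * (zeroSet_finite B).toFinset.card * m)) /
      (A : ℝ) ^ (((s + 1) * v - (2 * u + v) * (zeroSet_finite B).toFinset.card) * m) with hCst
  have hn1 : 1 ≤ v * m := by nlinarith
  have hx : (0 : ℝ) < (A : ℝ) * (v * m) - 1 := by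
    have : (3 : ℝ) ≤ A := by
      have h3 : 3 ≤ A := by rw [hA]; omega
      exact_mod_cast h3
    have : (1 : ℝ) ≤ (v * m : ℝ) := by exact_mod_cast hn1
    nlinarith
  obtain ⟨hsum, -⟩ := Literature.NumberTheory.Transcendental.OddZeta.tsum_one_div_add_pow_le hx (le_refl 2)
  have h2 : Summable fun q : ℕ => cT u v s B m θ (q + A * (v * m)) := by
    refine Summable.of_nonneg_of_le (fun q => (cT_pos u v s B m hθ0 _).le) (fun q => ?_) (hsum.mul_left Cst)
    have h := cT_le_tail (k := q + A * (v * m)) hv hm hs hNs hθ0 hθ1 (le_refl A) (by omega)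
    calc cT u v s B m θ (q + A * (v * m)) ≤ _ := h
      _ = Cst * (1 / ((q : ℝ) + 1 + ((A : ℝ) * (v * m) - 1)) ^ 2) := by
          rw [hCst]
          push_cast
          rw [show (q : ℝ) + 1 + ((A : ℝ) * (v * m) - 1) = q + A * (v * m) by ring]
          field_simp
  exact (summable_nat_add_iff (A * (v * m))).1 h2

/-- **`r_{n,θ} > 0`** (every term is positive). [cite: LaiYu2020, §4 proof of Lemma 4.1 (eq. (4.4))] -/
theorem rT_pos {u v s : ℕ} {B : ℝ} {m : ℕ} (hv : 1 ≤ v) (hm : 1 ≤ m) (hs : 2 ≤ s)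
    (hNs : (2 * u + v) * (zeroSet_finite B).toFinset.card ≤ (s + 1) * v)
    {θ : ℚ} (hθ0 : 0 < θ) (hθ1 : θ ≤ 1) : 0 < rT u v s B m θ := by
  rw [rT]
  exact (summable_cT hv hm hs hNs hθ0 hθ1).tsum_pos (fun k => (cT_pos u v s B m hθ0 k).le) 0
    (cT_pos u v s B m hθ0 0)

/-- **Tail bound**: `∑_{k ≥ An+1} R̂_n(k+θ) ≤ 2 (A₁A₂)ⁿ (2ev)^{(2u+v)Nm}/A^{dm}` for `A ≥ 2u+v+2`, together with the
summability of the shifted family. [cite: LaiYu2020, §4 proof of Lemma 4.1, eq. (4.9)] -/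
theorem tsum_tail_le {u v s : ℕ} {B : ℝ} {m : ℕ} (hv : 1 ≤ v) (hm : 1 ≤ m) (hs : 2 ≤ s)
    (hNs : (2 * u + v) * (zeroSet_finite B).toFinset.card ≤ (s + 1) * v)
    {θ : ℚ} (hθ0 : 0 < θ) (hθ1 : θ ≤ 1) {A : ℕ} (hA : 2 * u + v + 2 ≤ A) :
    Summable (fun q : ℕ => cT u v s B m θ (q + (A * (v * m) + 1))) ∧
      ∑' q : ℕ, cT u v s B m θ (q + (A * (v * m) + 1)) ≤
        2 * ((A₁pow u v B m : ℝ) * (A₂pow u v B m : ℝ) *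
          (2 * Real.exp 1 * v) ^ ((2 * u + v) * (zeroSet_finite B).toFinset.card * m)) /
          (A : ℝ) ^ (((s + 1) * v - (2 * u + v) * (zeroSet_finite B).toFinset.card) * m) := by
  set M : ℝ := 2 * ((A₁pow u v B m : ℝ) * (A₂pow u v B m : ℝ) *
      (2 * Real.exp 1 * v) ^ ((2 * u + v) * (zeroSet_finite B).toFinset.card * m)) /
      (A : ℝ) ^ (((s + 1) * v - (2 * u + v) * (zeroSet_finite B).toFinset.card) * m) with hM
  have hn1 : 1 ≤ v * m := by nlinarith
  have hA1 : (1 : ℝ) ≤ A := by exact_mod_cast (le_trans (by omega) hA : 1 ≤ A)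
  have hAn : (1 : ℝ) ≤ (A : ℝ) * (v * m) := by
    have : (1 : ℝ) ≤ (v * m : ℝ) := by exact_mod_cast hn1
    nlinarith
  have hx : (0 : ℝ) < (A : ℝ) * (v * m) := by linarith
  obtain ⟨hsum, hle⟩ := Literature.NumberTheory.Transcendental.OddZeta.tsum_one_div_add_pow_le hx (le_refl 2)
  have hM0 : 0 ≤ M := by
    rw [hM]
    have : (0 : ℝ) ≤ A₁pow u v B m := Nat.cast_nonneg _
    have : (0 : ℝ) ≤ A₂pow u v B m := Nat.cast_nonneg _
    positivity
  have hterm : ∀ q : ℕ, cT u v s B m θ (q + (A * (v * m) + 1)) ≤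
      M * (1 / ((q : ℝ) + 1 + (A : ℝ) * (v * m)) ^ 2) := by
    intro q
    have h := cT_le_tail (k := q + (A * (v * m) + 1)) hv hm hs hNs hθ0 hθ1 hA (by omega)
    calc cT u v s B m θ (q + (A * (v * m) + 1)) ≤ _ := h
      _ = M * (1 / ((q : ℝ) + 1 + (A : ℝ) * (v * m)) ^ 2) := by
          rw [hM]
          push_cast
          rw [show (q : ℝ) + ((A : ℝ) * (v * m) + 1) = q + 1 + A * (v * m) by ring]
          field_simp
  have hS : Summable (fun q : ℕ => cT u v s B m θ (q + (A * (v * m) + 1))) :=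
    Summable.of_nonneg_of_le (fun q => (cT_pos u v s B m hθ0 _).le) hterm (hsum.mul_left M)
  refine ⟨hS, ?_⟩
  calc ∑' q : ℕ, cT u v s B m θ (q + (A * (v * m) + 1))
      ≤ ∑' q : ℕ, M * (1 / ((q : ℝ) + 1 + (A : ℝ) * (v * m)) ^ 2) := hS.tsum_le_tsum hterm (hsum.mul_left M)
    _ = M * ∑' q : ℕ, 1 / ((q : ℝ) + 1 + (A : ℝ) * (v * m)) ^ 2 := tsum_mul_left
    _ ≤ M * 1 := by
        refine mul_le_mul_of_nonneg_left (hle.trans ?_) hM0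
        rw [div_le_one (by positivity)]
        nlinarith
    _ = M := mul_one M

/-- **The decomposition** `r_{n,θ} = ∑_{k < K} R̂_n(k+θ) + ∑_{k ≥ K} R̂_n(k+θ)`.
[cite: LaiYu2020, §4 proof of Lemma 4.1 ("we divide it into three parts")] -/
theorem rT_eq_sum_add_tail {u v s : ℕ} {B : ℝ} {m : ℕ} (hv : 1 ≤ v) (hm : 1 ≤ m) (hs : 2 ≤ s)
    (hNs : (2 * u + v) * (zeroSet_finite B).toFinset.card ≤ (s + 1) * v)
    {θ : ℚ} (hθ0 : 0 < θ) (hθ1 : θ ≤ 1) (K : ℕ) :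
    rT u v s B m θ = ∑ k ∈ range K, cT u v s B m θ k + ∑' q : ℕ, cT u v s B m θ (q + K) := by
  rw [rT, ← (summable_cT hv hm hs hNs hθ0 hθ1).sum_add_tsum_nat_add K]

/-- **Choice of the cut-off `A`**: `A ≥ 2u+v+2`, `A ≥ x₀ + 2` and
`(A₁A₂)^v (2ev)^{(2u+v)N} / A^d ≤ (g₀/2)^v` for any prescribed `g₀ > 0` (`d = (s+1)v − (2u+v)N ≥ 1`).
[cite: LaiYu2020, §4 proof of Lemma 4.1 (tail part: "when n ≥ max(10(2r+1), 10A₁(B)A₂(B)/g(x₀))")] -/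
theorem exists_A {u v s : ℕ} {B : ℝ} (hv : 1 ≤ v)
    (hNs : (2 * u + v) * (zeroSet_finite B).toFinset.card < (s + 1) * v) {x₀ g₀ : ℝ} (hg₀ : 0 < g₀) :
    ∃ A : ℕ, 2 * u + v + 2 ≤ A ∧ x₀ + 2 ≤ A ∧
      ((A₁ ((u : ℚ) / v) B * A₂ ((u : ℚ) / v) B) ^ v *
        (2 * Real.exp 1 * v) ^ ((2 * u + v) * (zeroSet_finite B).toFinset.card)) /
        (A : ℝ) ^ ((s + 1) * v - (2 * u + v) * (zeroSet_finite B).toFinset.card) ≤ (g₀ / 2) ^ v := by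
  set Cst : ℝ := (A₁ ((u : ℚ) / v) B * A₂ ((u : ℚ) / v) B) ^ v *
    (2 * Real.exp 1 * v) ^ ((2 * u + v) * (zeroSet_finite B).toFinset.card) with hCst
  have hC0 : 0 < Cst := by
    have := A₁_pos ((u : ℚ) / v) B
    have := A₂_pos ((u : ℚ) / v) B
    have : (0 : ℝ) < v := by exact_mod_cast hv
    positivity
  have hg : 0 < (g₀ / 2) ^ v := by positivity
  obtain ⟨A, hA⟩ := exists_nat_ge (max ((2 * u + v + 2 : ℕ) : ℝ) (max (x₀ + 2) (Cst / (g₀ / 2) ^ v)))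
  have h1 : ((2 * u + v + 2 : ℕ) : ℝ) ≤ A := le_trans (le_max_left _ _) hA
  have hx : x₀ + 2 ≤ A := le_trans ((le_max_left _ _).trans (le_max_right _ _)) hA
  have hAg : Cst / (g₀ / 2) ^ v ≤ A := le_trans ((le_max_right _ _).trans (le_max_right _ _)) hA
  refine ⟨A, by exact_mod_cast h1, hx, ?_⟩
  have hA1 : (1 : ℝ) ≤ A := by
    have : (1 : ℝ) ≤ ((2 * u + v + 2 : ℕ) : ℝ) := by exact_mod_cast (by omega : 1 ≤ 2 * u + v + 2)
    linarith
  have hd : 1 ≤ (s + 1) * v - (2 * u + v) * (zeroSet_finite B).toFinset.card := by omega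
  have hpow : (A : ℝ) ≤ (A : ℝ) ^ ((s + 1) * v - (2 * u + v) * (zeroSet_finite B).toFinset.card) :=
    le_self_pow₀ hA1 (by omega)
  calc Cst / (A : ℝ) ^ ((s + 1) * v - (2 * u + v) * (zeroSet_finite B).toFinset.card) ≤ Cst / A :=
        div_le_div_of_nonneg_left hC0.le (by linarith) hpow
    _ ≤ (g₀ / 2) ^ v := by
        rw [div_le_iff₀ (by linarith)]
        rw [div_le_iff₀ hg] at hAg
        linarith

/-- With such an `A`: `∑_{k > An} R̂_n(k+θ) ≤ 2 (g₀/2)ⁿ` (the printed (4.9), with `g₀ = g(x₀)`).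
[cite: LaiYu2020, §4 proof of Lemma 4.1, eq. (4.9)] -/
theorem tsum_tail_le_geom {u v s : ℕ} {B : ℝ} {m : ℕ} (hv : 1 ≤ v) (hm : 1 ≤ m) (hs : 2 ≤ s)
    (hNs : (2 * u + v) * (zeroSet_finite B).toFinset.card ≤ (s + 1) * v)
    {θ : ℚ} (hθ0 : 0 < θ) (hθ1 : θ ≤ 1) {A : ℕ} (hA : 2 * u + v + 2 ≤ A) {g₀ : ℝ}
    (hAg : ((A₁ ((u : ℚ) / v) B * A₂ ((u : ℚ) / v) B) ^ v *
        (2 * Real.exp 1 * v) ^ ((2 * u + v) * (zeroSet_finite B).toFinset.card)) /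
        (A : ℝ) ^ ((s + 1) * v - (2 * u + v) * (zeroSet_finite B).toFinset.card) ≤ (g₀ / 2) ^ v) :
    ∑' q : ℕ, cT u v s B m θ (q + (A * (v * m) + 1)) ≤ 2 * (g₀ / 2) ^ (v * m) := by
  have h := (tsum_tail_le hv hm hs hNs hθ0 hθ1 hA).2
  rw [A12_pow_eq hv B m] at h
  have hA0 : (0 : ℝ) < A := by exact_mod_cast (lt_of_lt_of_le (by omega) hA : 0 < A)
  have e : 2 * ((A₁ ((u : ℚ) / v) B * A₂ ((u : ℚ) / v) B) ^ v *
        (2 * Real.exp 1 * v) ^ ((2 * u + v) * (zeroSet_finite B).toFinset.card)) ^ m /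
        (A : ℝ) ^ (((s + 1) * v - (2 * u + v) * (zeroSet_finite B).toFinset.card) * m) =
      2 * (((A₁ ((u : ℚ) / v) B * A₂ ((u : ℚ) / v) B) ^ v *
        (2 * Real.exp 1 * v) ^ ((2 * u + v) * (zeroSet_finite B).toFinset.card)) /
        (A : ℝ) ^ ((s + 1) * v - (2 * u + v) * (zeroSet_finite B).toFinset.card)) ^ m := by
    rw [div_pow, ← pow_mul]
    ring
  rw [e] at h
  have hC0 : 0 ≤ ((A₁ ((u : ℚ) / v) B * A₂ ((u : ℚ) / v) B) ^ v *
        (2 * Real.exp 1 * v) ^ ((2 * u + v) * (zeroSet_finite B).toFinset.card)) /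
        (A : ℝ) ^ ((s + 1) * v - (2 * u + v) * (zeroSet_finite B).toFinset.card) := by
    have := A₁_pos ((u : ℚ) / v) B
    have := A₂_pos ((u : ℚ) / v) B
    positivity
  refine h.trans ?_
  rw [pow_mul (g₀ / 2) v m]
  exact mul_le_mul_of_nonneg_left (pow_le_pow_left₀ hC0 hAg m) (by norm_num)

/-! ### The body `k ≤ An`: uniform two-sided bounds -/

/-- **Uniform estimate on `1 ≤ k ≤ An`** and upper estimate on `0 ≤ k ≤ An`:
`|log R̂_n(k+θ) − nΛ(k/n)| ≤ B'(1 + log(n+1))`. [cite: LaiYu2020, §4 proof of Lemma 4.1, eq. (4.7)] -/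
theorem exists_body_bound (u v s : ℕ) (B : ℝ) (hv : 1 ≤ v) (A : ℕ) :
    ∃ B' : ℝ, 0 < B' ∧ ∀ m k : ℕ, ∀ θ : ℚ, 1 ≤ m → 1 ≤ u * m → 0 < θ → θ ≤ 1 → k ≤ A * (v * m) →
      (Real.log (cT u v s B m θ k) - ((v * m : ℕ) : ℝ) * Lam u v s B ((k : ℝ) / ((v * m : ℕ) : ℝ)) ≤
          B' * (1 + Real.log (((v * m : ℕ) : ℝ) + 1))) ∧
        (1 ≤ k → |Real.log (cT u v s B m θ k) - ((v * m : ℕ) : ℝ) * Lam u v s B ((k : ℝ) / ((v * m : ℕ) : ℝ))| ≤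
          B' * (1 + Real.log (((v * m : ℕ) : ℝ) + 1))) := by
  set C := Cunif u v s (zeroSet_finite B).toFinset.card with hC
  have hCpos : 0 < C := Cunif_pos u v s _
  have hA0 : (0 : ℝ) ≤ A := by positivity
  have hlA : 0 ≤ Real.log ((A : ℝ) + 1) := Real.log_nonneg (by linarith)
  refine ⟨C * (2 + Real.log ((A : ℝ) + 1)), by positivity, fun m k θ hm hum hθ0 hθ1 hk => ?_⟩
  have hn1 : 1 ≤ v * m := by nlinarith
  have hk' : (k : ℝ) ≤ A * ((v * m : ℕ) : ℝ) := by exact_mod_cast hk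
  have hn' : (1 : ℝ) ≤ ((v * m : ℕ) : ℝ) := by exact_mod_cast hn1
  have hlog : Real.log ((k : ℝ) + 1) ≤ Real.log ((A : ℝ) + 1) + Real.log (((v * m : ℕ) : ℝ) + 1) := by
    rw [← Real.log_mul (by linarith) (by linarith)]
    exact Real.log_le_log (by positivity) (by nlinarith)
  have hln : 0 ≤ Real.log (((v * m : ℕ) : ℝ) + 1) := Real.log_nonneg (by linarith)
  have hbound : C * (1 + Real.log (((v * m : ℕ) : ℝ) + 1) + Real.log ((k : ℝ) + 1)) ≤
      C * (2 + Real.log ((A : ℝ) + 1)) * (1 + Real.log (((v * m : ℕ) : ℝ) + 1)) := by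
    have := mul_nonneg hlA hln
    nlinarith
  refine ⟨(log_cT_sub_Lam_le hv hm hum hθ0 hθ1 k).trans hbound, fun hk1 => ?_⟩
  exact (abs_log_cT_sub_Lam_le hv hm hum hθ0 hθ1 hk1).trans hbound

/-- From the body estimate: two-sided exponential bounds for `R̂_n(k+θ)`.
[cite: LaiYu2020, §4 proof of Lemma 4.1, eq. (4.7)] -/
theorem cT_exp_bounds {u v s : ℕ} {B : ℝ} {m k : ℕ} {θ : ℚ} (hθ0 : 0 < θ) {X B' : ℝ}
    (h : |Real.log (cT u v s B m θ k) - X| ≤ B') :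
    cT u v s B m θ k ≤ Real.exp (X + B') ∧ Real.exp (X - B') ≤ cT u v s B m θ k := by
  have hc := cT_pos u v s B m hθ0 k
  rw [abs_le] at h
  constructor
  · calc cT u v s B m θ k = Real.exp (Real.log (cT u v s B m θ k)) := (Real.exp_log hc).symm
      _ ≤ _ := Real.exp_le_exp.2 (by linarith [h.2])
  · calc Real.exp (X - B') ≤ Real.exp (Real.log (cT u v s B m θ k)) := Real.exp_le_exp.2 (by linarith [h.1])
      _ = cT u v s B m θ k := Real.exp_log hc

/-! ### The limit `r_{n,θ}^{1/n} → g(x₀)` -/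

/-- `(1 + log(n+1))/n → 0` along `n = vm`, `m → ∞`. [cite: LaiYu2020, §4 proof of Lemma 4.1 (the factors n^{O(1)})] -/
theorem tendsto_one_add_log_div_mul {v : ℕ} (hv : 1 ≤ v) :
    Tendsto (fun m : ℕ => (1 + Real.log (((v * m : ℕ) : ℝ) + 1)) / ((v * m : ℕ) : ℝ)) atTop (𝓝 0) := by
  have hmul : Tendsto (fun m : ℕ => v * m) atTop atTop :=
    tendsto_id.const_mul_atTop' hv
  exact FischlerSprangZudilin2019.Lemma3.tendsto_one_add_log_div.comp hmul

/-- `(⌊x₀ n⌋+1)/n → x₀` along `n = vm`. [cite: LaiYu2020, §4 proof of Lemma 4.1 ("r_{n,1} ≥ R̂_n(⌊x₀n⌋)")] -/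
theorem tendsto_floor_succ_div {v : ℕ} (hv : 1 ≤ v) {x₀ : ℝ} (hx₀ : 0 ≤ x₀) :
    Tendsto (fun m : ℕ => ((⌊x₀ * ((v * m : ℕ) : ℝ)⌋₊ : ℝ) + 1) / ((v * m : ℕ) : ℝ)) atTop (𝓝 x₀) := by
  have hmul : Tendsto (fun m : ℕ => v * m) atTop atTop := tendsto_id.const_mul_atTop' hv
  have h1 : Tendsto (fun n : ℕ => (⌊x₀ * n⌋₊ : ℝ) / n) atTop (𝓝 x₀) :=
    (tendsto_nat_floor_mul_div_atTop hx₀).comp tendsto_natCast_atTop_atTop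
  have h2 : Tendsto (fun n : ℕ => (1 : ℝ) / n) atTop (𝓝 0) := tendsto_one_div_atTop_nhds_zero_nat
  have h := (h1.add h2).comp hmul
  rw [add_zero] at h
  refine h.congr fun m => ?_
  simp only [Function.comp_apply]
  rw [add_div]

/-- `⌊x₀ n⌋ + 1 ≤ An` when `x₀ + 2 ≤ A`, `n ≥ 1`. [cite: LaiYu2020, §4 proof of Lemma 4.1 (k = ⌊x₀n⌋)] -/
theorem floor_succ_le_mul {x₀ : ℝ} (hx₀ : 0 ≤ x₀) {A n : ℕ} (hA : x₀ + 2 ≤ A) (hn : 1 ≤ n) :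
    ⌊x₀ * n⌋₊ + 1 ≤ A * n := by
  have h1 : (⌊x₀ * n⌋₊ : ℝ) ≤ x₀ * n := Nat.floor_le (by positivity)
  have hn' : (1 : ℝ) ≤ n := by exact_mod_cast hn
  have h2 : x₀ * n + 1 ≤ (A : ℝ) * n := by nlinarith
  exact_mod_cast (show ((⌊x₀ * n⌋₊ : ℝ)) + 1 ≤ A * n by linarith)

/-- **Upper bound**: with `x₀` the root of `f`, `r_{n,θ} ≤ e^{nΛ(x₀)} exp(K(1 + log(n+1)))` for all `m ≥ 1` with
`um ≥ 1` and all `θ ∈ (0,1]` — the printed `r_{n,1} ≤ n^{O(1)} g(x₀)ⁿ` (`e^{Λ(x₀)} = g(x₀)`, `Lam_root`).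
[cite: LaiYu2020, §4 proof of Lemma 4.1 ("we have r_{n,1} ≤ n^{O(1)} g(x₀)ⁿ")] -/
theorem rT_le_exp {u v s : ℕ} {B : ℝ} (hu : 1 ≤ u) (hv : 1 ≤ v) (hs : 2 ≤ s)
    (hNs : (2 * u + v) * (zeroSet_finite B).toFinset.card < (s + 1) * v) {x₀ : ℝ} (hx₀ : 0 < x₀)
    (hlt : ∀ x, 0 < x → x < x₀ → 1 < fLY u v s (zeroSet_finite B).toFinset.card x)
    (hgt : ∀ x, x₀ < x → fLY u v s (zeroSet_finite B).toFinset.card x < 1) :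
    ∃ K : ℝ, 0 < K ∧ ∀ m : ℕ, ∀ θ : ℚ, 1 ≤ m → 0 < θ → θ ≤ 1 →
      rT u v s B m θ ≤ Real.exp (Lam u v s B x₀) ^ (v * m) *
        Real.exp (K * (1 + Real.log (((v * m : ℕ) : ℝ) + 1))) := by
  set g₀ := Real.exp (Lam u v s B x₀) with hg₀
  have hg : 0 < g₀ := Real.exp_pos _
  obtain ⟨A, hA, hAx, hAg⟩ := exists_A (u := u) (s := s) (B := B) hv hNs (x₀ := x₀) hg
  obtain ⟨B', hB', hbody⟩ := exists_body_bound u v s B hv A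
  have hA0 : (0 : ℝ) ≤ A := by positivity
  have hlA : 0 ≤ Real.log ((A : ℝ) + 1) := Real.log_nonneg (by linarith)
  refine ⟨B' + Real.log ((A : ℝ) + 1) + 2, by positivity, fun m θ hm hθ0 hθ1 => ?_⟩
  have hum : 1 ≤ u * m := by nlinarith
  have hn1 : 1 ≤ v * m := by nlinarith
  set n : ℕ := v * m with hn
  have hn' : (1 : ℝ) ≤ n := by exact_mod_cast hn1
  set ln := Real.log ((n : ℝ) + 1) with hln
  have hln0 : 0 ≤ ln := Real.log_nonneg (by linarith)
  -- the body terms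
  have hterm : ∀ k ∈ range (A * n + 1), cT u v s B m θ k ≤ g₀ ^ n * Real.exp (B' * (1 + ln)) := by
    intro k hk
    have hk' : k ≤ A * (v * m) := Nat.le_of_lt_succ (Finset.mem_range.1 hk)
    have h1 := (hbody m k θ hm hum hθ0 hθ1 hk').1
    have h2 : (n : ℝ) * Lam u v s B ((k : ℝ) / n) ≤ n * Lam u v s B x₀ :=
      mul_le_mul_of_nonneg_left (Lam_le_root hv hx₀ hlt hgt (by positivity)) (by positivity)
    have hc := cT_pos u v s B m hθ0 k
    calc cT u v s B m θ k = Real.exp (Real.log (cT u v s B m θ k)) := (Real.exp_log hc).symm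
      _ ≤ Real.exp (n * Lam u v s B x₀ + B' * (1 + ln)) := Real.exp_le_exp.2 (by rw [hn]; linarith)
      _ = g₀ ^ n * Real.exp (B' * (1 + ln)) := by rw [Real.exp_add, hg₀, ← Real.exp_nat_mul]
  have hbodysum : ∑ k ∈ range (A * n + 1), cT u v s B m θ k ≤
      ((A * n + 1 : ℕ) : ℝ) * (g₀ ^ n * Real.exp (B' * (1 + ln))) := by
    have := Finset.sum_le_card_nsmul _ _ _ hterm
    rwa [card_range, nsmul_eq_mul] at this
  -- the tail
  have htail : ∑' q : ℕ, cT u v s B m θ (q + (A * n + 1)) ≤ 2 * g₀ ^ n := by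
    refine (tsum_tail_le_geom (m := m) hv hm hs hNs.le hθ0 hθ1 hA hAg).trans ?_
    rw [← hn]
    have : (g₀ / 2) ^ n ≤ g₀ ^ n := pow_le_pow_left₀ (by positivity) (by linarith) n
    linarith
  rw [rT_eq_sum_add_tail hv hm hs hNs.le hθ0 hθ1 (A * n + 1)]
  -- (An+1) e^{B'(1+ln)} + 2 ≤ e^{K(1+ln)}
  set y := Real.log ((A : ℝ) + 1) + ln + B' * (1 + ln) with hy
  have hy0 : 0 ≤ y := by rw [hy]; positivity
  have hAn1 : ((A * n + 1 : ℕ) : ℝ) ≤ Real.exp (Real.log ((A : ℝ) + 1) + ln) := by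
    rw [Real.exp_add, Real.exp_log (by linarith), hln, Real.exp_log (by linarith)]
    push_cast
    nlinarith
  have hX : ((A * n + 1 : ℕ) : ℝ) * Real.exp (B' * (1 + ln)) ≤ Real.exp y := by
    rw [hy, Real.exp_add (Real.log ((A : ℝ) + 1) + ln)]
    exact mul_le_mul_of_nonneg_right hAn1 (by positivity)
  have he2 : (3 : ℝ) ≤ Real.exp 2 := by have := Real.add_one_le_exp (2 : ℝ); linarith
  have hX2 : Real.exp y + 2 ≤ Real.exp (y + 2) := by
    rw [Real.exp_add y 2]
    have h1 : (1 : ℝ) ≤ Real.exp y := Real.one_le_exp hy0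
    nlinarith [mul_le_mul_of_nonneg_left he2 (Real.exp_pos y).le, h1]
  have hK : y + 2 ≤ (B' + Real.log ((A : ℝ) + 1) + 2) * (1 + ln) := by
    rw [hy]
    have := mul_nonneg hlA hln0
    nlinarith
  calc ∑ k ∈ range (A * n + 1), cT u v s B m θ k + ∑' q : ℕ, cT u v s B m θ (q + (A * n + 1))
      ≤ ((A * n + 1 : ℕ) : ℝ) * (g₀ ^ n * Real.exp (B' * (1 + ln))) + 2 * g₀ ^ n := add_le_add hbodysum htail
    _ = g₀ ^ n * (((A * n + 1 : ℕ) : ℝ) * Real.exp (B' * (1 + ln)) + 2) := by ring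
    _ ≤ g₀ ^ n * Real.exp (y + 2) := mul_le_mul_of_nonneg_left (by linarith) (by positivity)
    _ ≤ g₀ ^ n * Real.exp ((B' + Real.log ((A : ℝ) + 1) + 2) * (1 + ln)) :=
        mul_le_mul_of_nonneg_left (Real.exp_le_exp.2 hK) (by positivity)

/-- **Lower bound** from the single term `k = ⌊x₀ n⌋ + 1`:
`exp(nΛ((⌊x₀n⌋+1)/n) − B'(1 + log(n+1))) ≤ r_{n,θ}`. [cite: LaiYu2020, §4 proof of Lemma 4.1 ("r_{n,1} ≥ R̂_n(⌊x₀n⌋) = n^{O(1)} h(x₀+o(1))ⁿ")] -/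
theorem exp_le_rT {u v s : ℕ} {B : ℝ} (hu : 1 ≤ u) (hv : 1 ≤ v) (hs : 2 ≤ s)
    (hNs : (2 * u + v) * (zeroSet_finite B).toFinset.card < (s + 1) * v) {x₀ : ℝ} (hx₀ : 0 < x₀) :
    ∃ B' : ℝ, 0 < B' ∧ ∀ m : ℕ, ∀ θ : ℚ, 1 ≤ m → 0 < θ → θ ≤ 1 →
      Real.exp (((v * m : ℕ) : ℝ) * Lam u v s B (((⌊x₀ * ((v * m : ℕ) : ℝ)⌋₊ : ℝ) + 1) / ((v * m : ℕ) : ℝ)) -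
        B' * (1 + Real.log (((v * m : ℕ) : ℝ) + 1))) ≤ rT u v s B m θ := by
  obtain ⟨A, -, hAx, -⟩ := exists_A (u := u) (s := s) (B := B) hv hNs (x₀ := x₀) one_pos
  obtain ⟨B', hB', hbody⟩ := exists_body_bound u v s B hv A
  refine ⟨B', hB', fun m θ hm hθ0 hθ1 => ?_⟩
  have hum : 1 ≤ u * m := by nlinarith
  have hn1 : 1 ≤ v * m := by nlinarith
  have hk := floor_succ_le_mul hx₀.le hAx hn1
  have h := (cT_exp_bounds (u := u) (v := v) (s := s) (B := B) (m := m) hθ0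
    ((hbody m _ θ hm hum hθ0 hθ1 hk).2 (by omega))).2
  simp only [Nat.cast_succ] at h
  refine h.trans ?_
  rw [rT]
  exact (summable_cT hv hm hs hNs.le hθ0 hθ1).le_tsum _ (fun k _ => (cT_pos u v s B m hθ0 k).le)

/-- **`log r_{n,θ} / n → Λ(x₀) = log g(x₀)`** along `n = vm`, for every `θ ∈ (0,1]`.
[cite: LaiYu2020, Lemma 4.1 (first assertion, logarithmic form)] -/
theorem tendsto_log_rT_div {u v s : ℕ} {B : ℝ} (hu : 1 ≤ u) (hv : 1 ≤ v) (hs : 2 ≤ s)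
    (hNs : (2 * u + v) * (zeroSet_finite B).toFinset.card < (s + 1) * v) {x₀ : ℝ} (hx₀ : 0 < x₀)
    (hlt : ∀ x, 0 < x → x < x₀ → 1 < fLY u v s (zeroSet_finite B).toFinset.card x)
    (hgt : ∀ x, x₀ < x → fLY u v s (zeroSet_finite B).toFinset.card x < 1)
    {θ : ℚ} (hθ0 : 0 < θ) (hθ1 : θ ≤ 1) :
    Tendsto (fun m : ℕ => Real.log (rT u v s B m θ) / ((v * m : ℕ) : ℝ)) atTop (𝓝 (Lam u v s B x₀)) := by
  obtain ⟨K, -, hup⟩ := rT_le_exp hu hv hs hNs hx₀ hlt hgt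
  obtain ⟨B', -, hlow⟩ := exp_le_rT (B := B) hu hv hs hNs hx₀
  set ℓ₀ := Lam u v s B x₀ with hℓ₀
  have hu' := tendsto_one_add_log_div_mul hv
  have hU : Tendsto (fun m : ℕ => ℓ₀ + K * ((1 + Real.log (((v * m : ℕ) : ℝ) + 1)) / ((v * m : ℕ) : ℝ)))
      atTop (𝓝 ℓ₀) := by
    simpa using tendsto_const_nhds.add (hu'.const_mul K)
  have hLcont : Tendsto (fun m : ℕ => Lam u v s B (((⌊x₀ * ((v * m : ℕ) : ℝ)⌋₊ : ℝ) + 1) / ((v * m : ℕ) : ℝ)))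
      atTop (𝓝 ℓ₀) :=
    ((continuous_Lam u v s B).tendsto x₀).comp (tendsto_floor_succ_div hv hx₀.le)
  have hL : Tendsto (fun m : ℕ => Lam u v s B (((⌊x₀ * ((v * m : ℕ) : ℝ)⌋₊ : ℝ) + 1) / ((v * m : ℕ) : ℝ)) -
      B' * ((1 + Real.log (((v * m : ℕ) : ℝ) + 1)) / ((v * m : ℕ) : ℝ))) atTop (𝓝 ℓ₀) := by
    simpa using hLcont.sub (hu'.const_mul B')
  refine tendsto_of_tendsto_of_tendsto_of_le_of_le' hL hU ?_ ?_
  · filter_upwards [eventually_ge_atTop 1] with m hm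
    have hn' : (0 : ℝ) < ((v * m : ℕ) : ℝ) := by
      have : 1 ≤ v * m := by nlinarith
      exact_mod_cast this
    have h := Real.log_le_log (Real.exp_pos _) (hlow m θ hm hθ0 hθ1)
    rw [Real.log_exp] at h
    rw [le_div_iff₀ hn']
    have e : (Lam u v s B (((⌊x₀ * ((v * m : ℕ) : ℝ)⌋₊ : ℝ) + 1) / ((v * m : ℕ) : ℝ)) -
        B' * ((1 + Real.log (((v * m : ℕ) : ℝ) + 1)) / ((v * m : ℕ) : ℝ))) * ((v * m : ℕ) : ℝ) =
        ((v * m : ℕ) : ℝ) * Lam u v s B (((⌊x₀ * ((v * m : ℕ) : ℝ)⌋₊ : ℝ) + 1) / ((v * m : ℕ) : ℝ)) -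
        B' * (1 + Real.log (((v * m : ℕ) : ℝ) + 1)) := by
      field_simp
    rw [e]
    exact h
  · filter_upwards [eventually_ge_atTop 1] with m hm
    have hn' : (0 : ℝ) < ((v * m : ℕ) : ℝ) := by
      have : 1 ≤ v * m := by nlinarith
      exact_mod_cast this
    have hr := rT_pos hv hm hs hNs.le hθ0 hθ1 (B := B)
    have h := Real.log_le_log hr (hup m θ hm hθ0 hθ1)
    rw [Real.log_mul (by positivity) (by positivity), Real.log_pow, Real.log_exp, Real.log_exp] at h
    rw [div_le_iff₀ hn']
    have e : (ℓ₀ + K * ((1 + Real.log (((v * m : ℕ) : ℝ) + 1)) / ((v * m : ℕ) : ℝ))) * ((v * m : ℕ) : ℝ) =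
        ((v * m : ℕ) : ℝ) * ℓ₀ + K * (1 + Real.log (((v * m : ℕ) : ℝ) + 1)) := by
      field_simp
    rw [e]
    exact h

/-- **Lai–Yu 2020, Lemma 4.1, first assertion** (PROVED, for every `θ ∈ (0,1]`, in particular `θ = 1`):
`r_{n,θ}^{1/n} → g(x₀)` along the admissible `n = vm → ∞`, where `x₀` is the positive root of `f(x) = 1`
(`u, v ≥ 1`, `s ≥ 2`, `(2u+v)|𝓕_B| < (s+1)v`). [cite: LaiYu2020, Lemma 4.1 ("lim_{n→+∞} (r_{n,1})^{1/n} = g(x₀)")] -/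
theorem tendsto_rT_rpow {u v s : ℕ} {B : ℝ} (hu : 1 ≤ u) (hv : 1 ≤ v) (hs : 2 ≤ s)
    (hNs : (2 * u + v) * (zeroSet_finite B).toFinset.card < (s + 1) * v) {x₀ : ℝ} (hx₀ : 0 < x₀)
    (hf1 : fLY u v s (zeroSet_finite B).toFinset.card x₀ = 1)
    (hlt : ∀ x, 0 < x → x < x₀ → 1 < fLY u v s (zeroSet_finite B).toFinset.card x)
    (hgt : ∀ x, x₀ < x → fLY u v s (zeroSet_finite B).toFinset.card x < 1)
    {θ : ℚ} (hθ0 : 0 < θ) (hθ1 : θ ≤ 1) :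
    Tendsto (fun m : ℕ => (rT u v s B m θ) ^ ((1 : ℝ) / ((v * m : ℕ) : ℝ))) atTop (𝓝 (gLY u v s B x₀)) := by
  have h := tendsto_log_rT_div hu hv hs hNs hx₀ hlt hgt hθ0 hθ1 (B := B)
  have hg := gLY_pos hu hv s B hx₀.le
  have h2 := (Real.continuous_exp.tendsto _).comp h
  rw [Lam_root hu hv s B hx₀ hf1, Real.exp_log hg] at h2
  refine h2.congr' ?_
  filter_upwards [eventually_ge_atTop 1] with m hm
  have hr := rT_pos hv hm hs hNs.le hθ0 hθ1 (B := B)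
  simp only [Function.comp_apply]
  rw [Real.rpow_def_of_pos hr, div_eq_mul_one_div]

end Lemma41

end Literature.NumberTheory.Irrationality.LaiYu2020
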